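import Literature.Topology.FourManifolds.Rasmussen
import Literature.Topology.FourManifolds.GaussDiagramsProofs
import Literature.Topology.FourManifolds.KnotsProofs
import Literature.Topology.FourManifolds.SliceGenusZeroProofs
import Literature.Topology.FourManifolds.SliceRibbonUnknotProofs
import Literature.Topology.FourManifolds.TorusKnotLee
import Literature.Topology.FourManifolds.TorusKnotProjection
import HarnessLib

/-!
# Rasmussen's `s`-invariant: proofs (sibling of `Rasmussen.lean`)

Sibling proof file of the statement file `Rasmussen.lean` (Rasmussen's theorems on the
concordance invariant `s(K)`, stated there as named facts). This file proves, with no new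
named fact (D-0026):

* `hasRasmussenInvariant_unknot_holds` — **discharge** of the named fact
  `Literature.Topology.FourManifolds.hasRasmussenInvariant_unknot` (`s(unknot) = 0`): the
  standard unknot has the empty Gauss diagram (`unknot_hasGaussDiagram_empty_holds`,
  `GaussDiagramsProofs.lean`) and the empty diagram has `s = s_max - 1 = 0`
  (`GaussDiagram.rasmussenInvariant_empty`, `LeeRasmussen.lean`); Rasmussen (2010), §3
  (remark after Def. 3.4) and proof of Thm. 1 (`s_max(U) = 1`, §4).
* `eq_zero_of_isSmoothlySlice_of_abs_le_two_mul_sliceGenus` — the named fact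
  `Literature.Topology.FourManifolds.eq_zero_of_isSmoothlySlice` (`s(K) = 0` for smoothly slice
  `K`) is the genus-`0` case of Rasmussen's slice-genus bound
  `Literature.Topology.FourManifolds.abs_le_two_mul_sliceGenus` (`|s(K)| ≤ 2 g₄(K)`, Rasmussen
  (2010), Thm. 1): a smoothly slice knot has `g₄ = 0`
  (`Knot.sliceGenus_eq_zero_of_isSmoothlySlice`, proved in `SliceGenusZeroProofs.lean`), so
  `|s| ≤ 0`. This is the printed argument; it no longer needs the named fact
  `Knot.sliceGenus_eq_zero_iff` quoted in the statement file.
* `eq_zero_of_isSmoothlySlice_of_eq_of_isConcordant` — the same fact from concordance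
  invariance `Literature.Topology.FourManifolds.HasRasmussenInvariant.eq_of_isConcordant`
  (Rasmussen (2010), Thm. 1–2): a smoothly slice knot is concordant to the unknot
  (`Knot.isSmoothlySlice_iff_isConcordant_unknot_holds`, Fox–Milnor (1966), proved in
  `SliceRibbonUnknotProofs.lean`) and `s(unknot) = 0` (`hasRasmussenInvariant_unknot_holds`).

* `hasRasmussenInvariant_torusKnot_holds` — **discharge** of the named fact
  `Literature.Topology.FourManifolds.hasRasmussenInvariant_torusKnot`
  (`s(T(p,q)) = (p-1)(q-1)` for coprime `p, q ≥ 2`; Rasmussen (2010), Thm. 4, §5.2), appended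
  2026-08-15: the torus knot `torusKnot p q` itself (isotopy is reflexive) has the standard
  positive Gauss diagram `torusGauss p q` (`TorusGauss.hasGaussDiagram_torusKnot`,
  `TorusKnotProjection.lean`: the stereographic projection of `z ↦ (zᵖ, z^q)/√2` is a closed
  positive `p`-braid with `(p-1)q` crossings), whose Rasmussen invariant is computed directly
  from Lee's complex (`TorusGauss.rasmussenInvariant_torusGauss`, `TorusKnotLee.lean`:
  `n₋ = 0`, the oriented resolution has `p` circles, `s_max = n - p + 2`,
  `s = n - p + 1 = (p-1)(q-1)`; the printed `s = -k + n + 1` of §5.2). The chirality question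
  flagged in the statement file is thereby settled: the accepted conventions give the positive
  torus knot, `s = +(p-1)(q-1)`.

So the discharge `eq_zero_of_isSmoothlySlice_holds` is exactly one application away from either
form of Rasmussen's Theorem 1 (`abs_le_two_mul_sliceGenus_holds` or
`HasRasmussenInvariant.eq_of_isConcordant_holds`), whose proof needs the maps on Lee homology
induced by link cobordisms (Rasmussen (2010), §4, Prop. 4.1), not yet in the tree.

## References

* J. Rasmussen, *Khovanov homology and the slice genus*, Invent. Math. 182 (2010) 419–447
  (arXiv:math/0402131): Thm. 1 (`|s(K)| ≤ 2 g_*(K)`, p. 2), its proof (§4, after Cor. 4.2: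
  `s_max(U) = 1`, filtered degree `-2g`), Thm. 2 (`s : Conc(S³) → ℤ`), Def. 3.4 and §3
  (`s(U) = 0`). [cite: Rasmussen2010, Thm. 1]
* J. Rasmussen, op. cit., Thm. 4 (`s(K) = 2g_*(K) = 2g(K)` for positive knots), Cor. 1 (torus
  knots), §5.2 "Positive knots" (`s(K) = -k + n + 1` for a positive diagram with `n` crossings
  and `k` circles in the oriented resolution). [cite: Rasmussen2010, Thm. 4]
* R. H. Fox, J. W. Milnor, *Singularities of 2-spheres in 4-space and cobordism of knots*,
  Osaka J. Math. 3 (1966), §3, Thm. 3 (slice iff concordant to the unknot). [cite: FoxMilnor1966]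
* The instance `SphereEmbedding.smoothnessFacts` (`KnotsProofs.lean`) supplies the
  `[SphereEmbedding.SmoothnessFacts]` hypothesis under which `unknot` is defined.

## Design notes

No definitions, no named facts, no `sorry`, no instances, no notation; imports are the statement
file plus the proof files supplying the bridges (`TorusKnotLee`, `TorusKnotProjection` for the
torus knots).
-/

open Function Set

noncomputable section

namespace Literature.Topology.FourManifolds

/-! ## The unknot: discharge of `hasRasmussenInvariant_unknot` -/

/-- **Discharge of the named fact `hasRasmussenInvariant_unknot`: the unknot has Rasmussen
invariant `0`.** Witnesses for `unknot.HasRasmussenInvariant 0`: the unknot itself (isotopy is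
reflexive, `SphereEmbedding.IsIsotopic.refl`), its empty Gauss diagram
(`unknot_hasGaussDiagram_empty_holds`: the round circle projects to the unit circle, no
crossings) and `GaussDiagram.rasmussenInvariant_empty` (`s_max(U) = 1`, `s(U) = s_max - 1 = 0`).
Rasmussen (2010), §3 (remark after Def. 3.4), §4 (proof of Thm. 1: `s_max(U) = 1`).
[cite: Rasmussen2010, Def. 3.4] -/
theorem hasRasmussenInvariant_unknot_holds : hasRasmussenInvariant_unknot :=
  ⟨unknot, GaussDiagram.empty, SphereEmbedding.IsIsotopic.refl _,
    unknot_hasGaussDiagram_empty_holds, GaussDiagram.rasmussenInvariant_empty⟩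

/-! ## Slice knots have `s = 0`: reductions to Rasmussen's Theorem 1 -/

/-- **`s(K) = 0` for smoothly slice `K`, from the slice-genus bound** (the printed argument):
if `|s(K)| ≤ 2 g₄(K)` for all knots (the named fact `abs_le_two_mul_sliceGenus`, Rasmussen
(2010), Thm. 1), then a smoothly slice knot, which has `g₄(K) = 0`
(`Knot.sliceGenus_eq_zero_of_isSmoothlySlice`: its slice disc restricted to `𝔻²` is a slice
surface of genus `0`), has `|s(K)| ≤ 0`, i.e. `s(K) = 0`. Rasmussen (2010), Thm. 1 (case
`g_* = 0`), proof in §4. [cite: Rasmussen2010, Thm. 1] -/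
theorem eq_zero_of_isSmoothlySlice_of_abs_le_two_mul_sliceGenus
    (h : abs_le_two_mul_sliceGenus) : eq_zero_of_isSmoothlySlice := by
  intro K s hK hs
  have h0 : K.sliceGenus = 0 := Knot.sliceGenus_eq_zero_of_isSmoothlySlice hs
  have hle : |s| ≤ 2 * (K.sliceGenus : ℤ) := h hK
  rw [h0, Nat.cast_zero, mul_zero] at hle
  exact abs_nonpos_iff.1 hle

/-- **`s(K) = 0` for smoothly slice `K`, from concordance invariance**: if concordant knots
have equal Rasmussen invariants (the named fact `HasRasmussenInvariant.eq_of_isConcordant`,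
Rasmussen (2010), Thm. 1–2), then a smoothly slice knot, being concordant to the unknot
(`Knot.isSmoothlySlice_iff_isConcordant_unknot_holds`, Fox–Milnor (1966), §3, Thm. 3), has
`s(K) = s(U) = 0` (`hasRasmussenInvariant_unknot_holds`). Rasmussen (2010), Thm. 1 and proof of
Thm. 2 (§4: slice knots have `s = 0`). [cite: Rasmussen2010, Thm. 1] -/
theorem eq_zero_of_isSmoothlySlice_of_eq_of_isConcordant
    (h : HasRasmussenInvariant.eq_of_isConcordant) : eq_zero_of_isSmoothlySlice := by
  intro K s hK hs
  exact h hK hasRasmussenInvariant_unknot_holds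
    (Knot.isSmoothlySlice_iff_isConcordant_unknot_holds.1 hs)

/-! ## Torus knots: discharge of `hasRasmussenInvariant_torusKnot` -/

/-- **Discharge of the named fact `hasRasmussenInvariant_torusKnot`: `s(T(p,q)) = (p-1)(q-1)`**
for coprime `p, q ≥ 2` (Rasmussen (2010), Thm. 4; §5.2: a positive diagram with `n` crossings
whose oriented resolution has `k` circles has `s = -k + n + 1`, here `n = (p-1)q`, `k = p`).
Witnesses for `(torusKnot p q hp hq h).HasRasmussenInvariant ((p-1)(q-1))`: the torus knot itself
(`SphereEmbedding.IsIsotopic.refl`), its standard positive Gauss diagram `torusGauss p q`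
realised by the stereographic projection (`TorusGauss.hasGaussDiagram_torusKnot`), and the
value `(torusGauss p q).rasmussenInvariant = (p-1)(q-1)` computed from Lee's complex
(`TorusGauss.rasmussenInvariant_torusGauss`). Unconditional: no named fact is used.
[cite: Rasmussen2010, Thm. 4] -/
theorem hasRasmussenInvariant_torusKnot_holds : hasRasmussenInvariant_torusKnot := by
  intro p q hp hq h
  exact ⟨torusKnot p q hp hq h, torusGauss p q, SphereEmbedding.IsIsotopic.refl _,
    TorusGauss.hasGaussDiagram_torusKnot p q hp hq h,
    TorusGauss.rasmussenInvariant_torusGauss p q hp (le_trans (by norm_num) hq) h⟩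

end Literature.Topology.FourManifolds
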